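import Summits.FinalStateConjecture.FinalStateConjecture.Theorems.KerrShieldedDataExist.Negative.BentSliceConormal
import Summits.FinalStateConjecture.FinalStateConjecture.Theorems.KerrShieldedSettles.Negative.StationaryBendDead
import Summits.FinalStateConjecture.FinalStateConjecture.Theorems.KerrShieldedSettles.Negative.OrientationAndHoleCollar
import Literature.Geometry.Lorentzian.KerrSchildDivergence
import Literature.Geometry.Lorentzian.ConvergenceTransport
import HarnessLib

/-!
# `KerrShieldedSettles`, line `tapered-temporal-collar` — stub S1 `stub_collarCauchy`, part 1 (pointwise clocks)

Support file for crux `stmt-FinalStateConjecture-10054`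
(`Summit.FinalStateConjecture.FinalStateConjecture.Theses.SwallowTheDatum.KerrShieldedSettles`), stub
`stub_collarCauchy` (the bent leaf `{x⁰ = T(r)}` is a Cauchy hypersurface of the tapered collar
`W = {0 < x⁰ − T(r) + (r − r₁)/4}` of the ingoing Kerr–Schild chart).  This part is the POINTWISE
Kerr–Schild linear algebra of the three clocks used by the curve-level argument of part 2
(`SwallowTheDatumKerrShieldedSettlesStubCollarCauchy.lean`):

* `clock_pos` / `clock_neg`: for a constant slope `c`, the covector `n = dt* − c dr` at a point with `r > 0`
  has `Σ·g⁻¹(n, n) = −Σ + c²(r² + a²) − 2Mr(1 + c)²` and `n(V) = 1 + 2H(1 + c)` (`V = Kerr.timeVector`;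
  the tree's `Kerr.coSharp`, `Kerr.leafConormal_coSharp_of_radial`, `Kerr.leafConormal_timeVector_of_radial`
  for the radial height `y ↦ c·r(0, y)`); when the first is negative, `∓g♯n` is future timelike according
  to the sign of the second, and the timecone lemma (`LorentzianMetric.val_lt_zero_of_isCausal`) gives
  `n(v) > 0`, resp. `n(v) < 0`, for every future-directed causal `v`;
* the three numerators: slope `T′(r)` (`u = t* − T(r)`; `conormalForm_bentSlope_neg` at latitude `0` and
  `r² ≤ Σ`), slope `T′(r) − ¼` (`w = u + (r − r₁)/4`; needs `r > r₋`: `a² = r₊r₋ < 2Mr` below `4M`,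
  convexity in the slope above), and a large negative slope `−K` in the hole `r₋ < r < r₊`
  (`Δ < 0`, `H > 0`: the hole clock `dr < 0`);
* `0 ≤ T` and the sublinear growth `T(r) ≤ r/2 + M` (from `bentHeight_le_two_mul_log`, `log 2 < 0.6932`).

References: O'Neill 1983, Ch. 5 (timecones), Ch. 14 (Cauchy hypersurfaces); Dafermos–Rodnianski
arXiv:0811.0354 §5.1 (ingoing Kerr–Schild chart); O'Neill 1995, Ch. 2 (`r` is a time function between the
horizons).
-/

set_option linter.dupNamespace false

noncomputable section

open Set Filter
open scoped Manifold ContDiff Topology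
open Literature.Geometry.Lorentzian
open Summit.FinalStateConjecture.FinalStateConjecture.Theorems.KerrShieldedDataExist.Negative
  (bentHeight bentSlope mass_pos conormalForm conormalForm_bentSlope_neg
  bentSlope_nonneg bentSlope_eq_zero_of_le rPlus_lt_four_mul rPlus_mul_rMinus rPlus_le_two_mul
  rMinus_nonneg delta_pos bentHeight_eq_zero_of_le blHeight_sub_nonneg log_two_lt)
open Summit.FinalStateConjecture.FinalStateConjecture.Theorems.KerrShieldedSettles.Negative
  (sq_add_sq_lt_of_mem_hole bentHeight_le_two_mul_log)

namespace Summit.FinalStateConjecture.FinalStateConjecture.Theorems.SwallowTheDatum.KerrShieldedSettles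

namespace CollarCauchy

/-! ## Pointwise Kerr–Schild clocks: the covectors `dt* − c dr` -/

section Clocks

variable {M a : ℝ}

/-- **Timecone lemma in the Kerr–Schild chart.** At a point with `r > 0` (`M ≥ 0`), a vector `N`
with `g(N, N) < 0` and `g(V, N) < 0` (`V = Kerr.timeVector`) pairs negatively with every
future-directed causal `v`. O'Neill 1983, Ch. 5, Lemma 5.29. [cite: ONeillSemiRiemannian1983, Ch. 5, Lemma 5.29 (p. 143)] -/
theorem bilin_neg_of_cone [Kerr.Facts] (hM : 0 ≤ M) {x : E4} (hx : 0 < Kerr.radius a x)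
    {N v : E4} (hNN : Kerr.bilin M a x N N < 0)
    (hVN : Kerr.bilin M a x (Kerr.timeVector M a x) N < 0) (hvv : Kerr.bilin M a x v v ≤ 0)
    (hv0 : v ≠ 0) (hVv : Kerr.bilin M a x (Kerr.timeVector M a x) v < 0) :
    Kerr.bilin M a x N v < 0 := by
  have hmem : x ∈ Kerr.region a 0 := by rw [Kerr.mem_region, max_self]; exact hx
  exact (Kerr.metric M a 0).val_lt_zero_of_isCausal (x := (⟨x, hmem⟩ : Kerr.region a 0))
    (T := Kerr.timeVector M a x) (T' := N) (v := v) (Kerr.bilin_timeVector_timeVector_neg hM a hx)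
    hNN hVN ⟨hvv, hv0⟩ hVv

/-- `r² ≤ Σ` at a point of `E4` with `r > 0` (`Σ = Kerr.blSigma a x⃗`). [folklore] -/
theorem sq_le_blSigma_spatial {x : E4} (hx : 0 < Kerr.radius a x) :
    Kerr.radius a x ^ 2 ≤ Kerr.blSigma a (E4.spatial x) := by
  have hr : 0 < Kerr.radius a (E4.ofTimeSpace 0 (E4.spatial x)) := by
    rwa [Kerr.radius_ofTimeSpace_spatial]
  have h := Kerr.sq_le_blSigma hr
  rwa [Kerr.radius_ofTimeSpace_spatial] at h

/-- **The clock `dt* − c dr` runs forward** along future causal vectors whenever it is timelike,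
`−Σ + c²(r² + a²) − 2Mr(1 + c)² < 0`, and co-oriented with `dt*`, `1 + 2H(1 + c) > 0`:
`v⁰ − c dr(v⃗) > 0` (the vector `−g♯(dt* − c dr)` is then future timelike; `Kerr.coSharp`,
`Kerr.leafConormal_coSharp_of_radial`). Dafermos–Rodnianski arXiv:0811.0354, §5.1. [cite: arXiv08110354, §5.1] -/
theorem clock_pos [Kerr.Facts] (hM : 0 ≤ M) {x : E4} (hx : 0 < Kerr.radius a x) {c : ℝ}
    (hnum : -Kerr.blSigma a (E4.spatial x) + c ^ 2 * (Kerr.radius a x ^ 2 + a ^ 2) -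
        2 * M * Kerr.radius a x * (1 + c) ^ 2 < 0)
    (hco : 0 < 1 + 2 * Kerr.scalarH M a x * (1 + c))
    {v : E4} (hvv : Kerr.bilin M a x v v ≤ 0) (hv0 : v ≠ 0)
    (hVv : Kerr.bilin M a x (Kerr.timeVector M a x) v < 0) :
    0 < v 0 - c * Kerr.radiusGrad a (E4.spatial x) (E4.spatial v) := by
  obtain ⟨t, y, rfl⟩ : ∃ t y, x = E4.ofTimeSpace t y :=
    ⟨_, _, (E4.ofTimeSpace_time_spatial x).symm⟩
  have hr : 0 < Kerr.radius a (E4.ofTimeSpace 0 y) := by rwa [← Kerr.radius_ofTimeSpace a t y]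
  rw [Kerr.radius_ofTimeSpace a t y, E4.spatial_ofTimeSpace] at hnum
  rw [E4.spatial_ofTimeSpace]
  set h : E3 → ℝ := fun y' => c * Kerr.radius a (E4.ofTimeSpace 0 y') with hh_def
  have hh : fderiv ℝ h y = c • Kerr.radiusGrad a y :=
    ((Kerr.hasFDerivAt_radius_slice hr).const_mul c).fderiv
  set n := Kerr.leafConormal h (E4.ofTimeSpace t y) with hn
  set N : E4 := -Kerr.coSharp M a (E4.ofTimeSpace t y) n with hN
  have hNw : ∀ w, Kerr.bilin M a (E4.ofTimeSpace t y) N w = -n w := fun w => by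
    rw [hN, (Kerr.bilin M a _).map_neg, _root_.neg_apply, Kerr.bilin_coSharp M a hx]
  have hNN : Kerr.bilin M a (E4.ofTimeSpace t y) N N < 0 := by
    rw [hN, E4.bilin_neg_neg, Kerr.bilin_coSharp M a hx, hn,
      Kerr.leafConormal_coSharp_of_radial hh hr]
    exact div_neg_of_neg_of_pos hnum (Kerr.blSigma_pos hr)
  have hVN : Kerr.bilin M a (E4.ofTimeSpace t y) (Kerr.timeVector M a (E4.ofTimeSpace t y)) N < 0 := by
    rw [Kerr.bilin_symm, hNw, hn, Kerr.leafConormal_timeVector_of_radial hh hr]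
    linarith
  have key := bilin_neg_of_cone hM hx hNN hVN hvv hv0 hVv
  rw [hNw, hn, Kerr.leafConormal_apply_of_radial hh] at key
  linarith

/-- **The clock `dt* − c dr` runs backward** along future causal vectors when it is timelike and
ANTI-oriented, `1 + 2H(1 + c) < 0`: `v⁰ − c dr(v⃗) < 0` (`g♯(dt* − c dr)` is future timelike).
Dafermos–Rodnianski arXiv:0811.0354, §5.1. [cite: arXiv08110354, §5.1] -/
theorem clock_neg [Kerr.Facts] (hM : 0 ≤ M) {x : E4} (hx : 0 < Kerr.radius a x) {c : ℝ}
    (hnum : -Kerr.blSigma a (E4.spatial x) + c ^ 2 * (Kerr.radius a x ^ 2 + a ^ 2) -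
        2 * M * Kerr.radius a x * (1 + c) ^ 2 < 0)
    (hco : 1 + 2 * Kerr.scalarH M a x * (1 + c) < 0)
    {v : E4} (hvv : Kerr.bilin M a x v v ≤ 0) (hv0 : v ≠ 0)
    (hVv : Kerr.bilin M a x (Kerr.timeVector M a x) v < 0) :
    v 0 - c * Kerr.radiusGrad a (E4.spatial x) (E4.spatial v) < 0 := by
  obtain ⟨t, y, rfl⟩ : ∃ t y, x = E4.ofTimeSpace t y :=
    ⟨_, _, (E4.ofTimeSpace_time_spatial x).symm⟩
  have hr : 0 < Kerr.radius a (E4.ofTimeSpace 0 y) := by rwa [← Kerr.radius_ofTimeSpace a t y]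
  rw [Kerr.radius_ofTimeSpace a t y, E4.spatial_ofTimeSpace] at hnum
  rw [E4.spatial_ofTimeSpace]
  set h : E3 → ℝ := fun y' => c * Kerr.radius a (E4.ofTimeSpace 0 y') with hh_def
  have hh : fderiv ℝ h y = c • Kerr.radiusGrad a y :=
    ((Kerr.hasFDerivAt_radius_slice hr).const_mul c).fderiv
  set n := Kerr.leafConormal h (E4.ofTimeSpace t y) with hn
  set N : E4 := Kerr.coSharp M a (E4.ofTimeSpace t y) n with hN
  have hNw : ∀ w, Kerr.bilin M a (E4.ofTimeSpace t y) N w = n w := fun w => by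
    rw [hN, Kerr.bilin_coSharp M a hx]
  have hNN : Kerr.bilin M a (E4.ofTimeSpace t y) N N < 0 := by
    rw [hNw, hN, hn, Kerr.leafConormal_coSharp_of_radial hh hr]
    exact div_neg_of_neg_of_pos hnum (Kerr.blSigma_pos hr)
  have hVN : Kerr.bilin M a (E4.ofTimeSpace t y) (Kerr.timeVector M a (E4.ofTimeSpace t y)) N < 0 := by
    rw [Kerr.bilin_symm, hNw, hn, Kerr.leafConormal_timeVector_of_radial hh hr]
    exact hco
  have key := bilin_neg_of_cone hM hx hNN hVN hvv hv0 hVv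
  rwa [hNw, hn, Kerr.leafConormal_apply_of_radial hh] at key

end Clocks

/-! ## The three numerators: slopes `T′`, `T′ − ¼`, and `−K` in the hole -/

section Numerators

variable {M a : ℝ}

/-- A convex quadratic is negative on a segment if it is negative at both ends. [folklore] -/
theorem quad_neg_of_ends {D L K lo hi c : ℝ} (hD : 0 ≤ D) (hlo : lo ≤ c) (hhi : c ≤ hi)
    (h1 : D * lo ^ 2 + L * lo + K < 0) (h2 : D * hi ^ 2 + L * hi + K < 0) :
    D * c ^ 2 + L * c + K < 0 := by
  rcases le_or_gt 0 (D * (c + hi) + L) with h | h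
  · nlinarith [mul_nonneg (sub_nonneg.2 hhi) h]
  · have h' : D * (c + lo) + L < 0 := by nlinarith [mul_le_mul_of_nonneg_left hhi hD]
    nlinarith [mul_nonpos_of_nonneg_of_nonpos (sub_nonneg.2 hlo) h'.le]

/-- **Numerator of the `u`-clock** (`u = t* − T(r)`, slope `T′(r)`): `−Σ + T′²(r² + a²) − 2Mr(1 + T′)² < 0`
at every point with `r > 0` (`conormalForm_bentSlope_neg` at latitude `0` and `r² ≤ Σ`). [folklore] -/
theorem numerator_bentSlope_neg (ha : |a| < M) {x : E4} (hx : 0 < Kerr.radius a x) :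
    -Kerr.blSigma a (E4.spatial x) + bentSlope M a (Kerr.radius a x) ^ 2 *
        (Kerr.radius a x ^ 2 + a ^ 2) -
      2 * M * Kerr.radius a x * (1 + bentSlope M a (Kerr.radius a x)) ^ 2 < 0 := by
  have h1 := conormalForm_bentSlope_neg ha hx 0
  have h2 := sq_le_blSigma_spatial hx
  unfold conormalForm at h1
  nlinarith

/-- **Numerator of the `w`-clock** (`w = u + (r − r₁)/4`, slope `T′(r) − ¼`): negative at every point with
`r > r₋` (below `4M`: `T′ = 0` and `a² = r₊r₋ < 2Mr`; above `4M`: convexity in the slope between `−¼` and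
`T′`). [folklore] -/
theorem numerator_bentSlope_sub_quarter_neg (ha : |a| < M) {x : E4} (hx : 0 < Kerr.radius a x)
    (hm : Kerr.rMinus M a < Kerr.radius a x) :
    -Kerr.blSigma a (E4.spatial x) + (bentSlope M a (Kerr.radius a x) - 1 / 4) ^ 2 *
        (Kerr.radius a x ^ 2 + a ^ 2) -
      2 * M * Kerr.radius a x * (1 + (bentSlope M a (Kerr.radius a x) - 1 / 4)) ^ 2 < 0 := by
  have hM := mass_pos ha
  have hSig := sq_le_blSigma_spatial hx
  set r := Kerr.radius a x with hr
  have ha2 : a ^ 2 = Kerr.rPlus M a * Kerr.rMinus M a := (rPlus_mul_rMinus ha).symm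
  have hp2 := rPlus_le_two_mul ha
  have hm0 := rMinus_nonneg ha
  have ha2r : a ^ 2 < 2 * M * r := by
    rw [ha2]
    calc Kerr.rPlus M a * Kerr.rMinus M a ≤ 2 * M * Kerr.rMinus M a :=
          mul_le_mul_of_nonneg_right hp2 hm0
      _ < 2 * M * r := by nlinarith
  rcases le_or_gt r (4 * M) with h4 | h4
  · rw [bentSlope_eq_zero_of_le hM h4]
    nlinarith
  · have hrp : Kerr.rPlus M a < r := (rPlus_lt_four_mul ha).trans h4
    have hΔ := delta_pos ha hrp
    have hκ := bentSlope_nonneg ha r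
    have hQ := conormalForm_bentSlope_neg ha hx 0
    unfold conormalForm at hQ
    set κ := bentSlope M a r
    have haM : a ^ 2 < M ^ 2 := by nlinarith [abs_nonneg a, sq_abs a, abs_lt.1 ha]
    -- convexity between the slopes `-1/4` and `κ`
    have key : (r ^ 2 - 2 * M * r + a ^ 2) * (κ - 1 / 4) ^ 2 + (-(4 * M * r)) * (κ - 1 / 4) +
        (-(2 * M * r) - r ^ 2) < 0 := by
      refine quad_neg_of_ends hΔ.le (lo := -1 / 4) (hi := κ) (by linarith) (by linarith) ?_ ?_
      · nlinarith
      · nlinarith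
    nlinarith

/-- **The hole clock**: for `r₋ < r < r₊` there is `K > 0` such that the covector `dt* + K dr` is timelike
and ANTI-oriented (`Δ < 0`, `H > 0`), so that `dr < 0` on future causal vectors. O'Neill 1995, Ch. 2
(`r` is a time function between the horizons). [folklore] -/
theorem exists_hole_slope (ha : |a| < M) {x : E4} (hx : 0 < Kerr.radius a x)
    (h₁ : Kerr.rMinus M a < Kerr.radius a x) (h₂ : Kerr.radius a x < Kerr.rPlus M a) :
    ∃ K : ℝ, 0 < K ∧
      -Kerr.blSigma a (E4.spatial x) + (-K) ^ 2 * (Kerr.radius a x ^ 2 + a ^ 2) -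
          2 * M * Kerr.radius a x * (1 + -K) ^ 2 < 0 ∧
      1 + 2 * Kerr.scalarH M a x * (1 + -K) < 0 := by
  have hM := mass_pos ha
  have hSig := sq_le_blSigma_spatial hx
  have hhole := sq_add_sq_lt_of_mem_hole ha h₁ h₂
  set r := Kerr.radius a x with hr
  set S := Kerr.blSigma a (E4.spatial x) with hS
  have hH : 0 < Kerr.scalarH M a x := by
    rw [Kerr.scalarH_eq_div_blSigma M a hx]
    exact div_pos (mul_pos hM hx) (Kerr.blSigma_spatial_pos hx)
  set H := Kerr.scalarH M a x with hHdef
  set D := 2 * M * r - (r ^ 2 + a ^ 2) with hD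
  have hDpos : 0 < D := by rw [hD]; linarith
  refine ⟨4 * M * r / D + 1 / (2 * H) + 2, by positivity, ?_, ?_⟩
  · set K := 4 * M * r / D + 1 / (2 * H) + 2 with hK
    have hK1 : 4 * M * r / D ≤ K := by
      rw [hK]; have : 0 < 1 / (2 * H) := by positivity
      linarith
    have hK0 : 0 ≤ K := le_trans (by positivity) hK1
    -- `K · (4Mr − D K) ≤ 0`
    have hDK : 4 * M * r ≤ D * K := by
      calc 4 * M * r = D * (4 * M * r / D) := by field_simp
        _ ≤ D * K := mul_le_mul_of_nonneg_left hK1 hDpos.le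
    have h3 : K * (4 * M * r - D * K) ≤ 0 :=
      mul_nonpos_of_nonneg_of_nonpos hK0 (by linarith)
    have h4 : 0 < 2 * M * r := by positivity
    nlinarith
  · have h1 : 1 < 2 * H * (4 * M * r / D + 1 / (2 * H) + 2 - 1) := by
      have e : 2 * H * (1 / (2 * H)) = 1 := by field_simp
      have : 0 ≤ 4 * M * r / D := by positivity
      nlinarith
    nlinarith

end Numerators

/-! ## Height bounds: `0 ≤ T ≤ r/2 + M` -/

section Bounds

variable {M a : ℝ}

/-- `T ≥ 0` (both factors of the hard-coded height are nonnegative above `4M`, `T = 0` below). [folklore] -/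
theorem bentHeight_nonneg (ha : |a| < M) (r : ℝ) : 0 ≤ bentHeight M a r := by
  have hM := mass_pos ha
  rcases le_or_gt r (4 * M) with h4 | h4
  · rw [bentHeight_eq_zero_of_le hM h4]
  · exact mul_nonneg (Real.smoothTransition.nonneg _) (blHeight_sub_nonneg ha h4.le)

/-- **The bent height grows sublinearly with slope below `½`**: `T(r) ≤ r/2 + M` for `r ≥ 0`
(`T ≤ 2M log(r/M)`, `log(r/M) = log 4 + log(r/4M) ≤ log 4 + r/(4M) − 1`, `log 2 < 0.6932`). [folklore] -/
theorem bentHeight_le_half_add (ha : |a| < M) {r : ℝ} (hr : 0 ≤ r) :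
    bentHeight M a r ≤ r / 2 + M := by
  have hM := mass_pos ha
  rcases le_or_gt r (4 * M) with h4 | h4
  · rw [bentHeight_eq_zero_of_le hM h4]; positivity
  · have hT := bentHeight_le_two_mul_log ha (show M ≤ r by linarith)
    have hq : 0 < r / (4 * M) := div_pos (by linarith) (by linarith)
    have hlog : Real.log (r / M) = Real.log 2 + Real.log 2 + Real.log (r / (4 * M)) := by
      rw [← Real.log_mul (by norm_num) (by norm_num), ← Real.log_mul (by norm_num) hq.ne']
      congr 1
      field_simp
      ring
    have hle := Real.log_le_sub_one_of_pos hq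
    have h2 := log_two_lt
    have key : 2 * M * Real.log (r / M) ≤ r / 2 + M := by
      rw [hlog]
      have : 2 * M * (Real.log 2 + Real.log 2 + Real.log (r / (4 * M))) ≤
          2 * M * (0.6932 + 0.6932 + (r / (4 * M) - 1)) :=
        mul_le_mul_of_nonneg_left (by linarith) (by linarith)
      refine this.trans ?_
      have e : 2 * M * (0.6932 + 0.6932 + (r / (4 * M) - 1)) = r / 2 + 2 * M * (0.3864 : ℝ) := by
        field_simp
        ring
      rw [e]
      nlinarith
    exact hT.trans key

end Bounds

end CollarCauchy

/-- **Registered sub-goal `stub_collarCauchyClock` (the Kerr–Schild radial clock, both orientations).**  At a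
point of the ingoing Kerr–Schild chart with `r > 0` (`M ≥ 0`) and for a constant slope `c` such that the
covector `n = dt* − c dr` is timelike, `−Σ + c²(r² + a²) − 2Mr(1 + c)² < 0`: for every future-directed causal
`v` (`g(v,v) ≤ 0`, `v ≠ 0`, `g(V,v) < 0`), `n(v) = v⁰ − c dr(v⃗)` is positive when `n(V) = 1 + 2H(1 + c) > 0`
and negative when `n(V) < 0` (`CollarCauchy.clock_pos`, `CollarCauchy.clock_neg`).  This is the pointwise
engine of `stub_collarCauchy` (slopes `T′`, `T′ − ¼`, and `−K` in the hole). O'Neill 1983, Ch. 5,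
Lemma 5.29; Dafermos–Rodnianski arXiv:0811.0354, §5.1. [cite: ONeillSemiRiemannian1983, Ch. 5, Lemma 5.29 (p. 143)] -/
theorem stub_collarCauchyClock : ∀ [Kerr.Facts] (M a : ℝ), 0 ≤ M → ∀ (x : E4), 0 < Kerr.radius a x →
    ∀ (c : ℝ), -Kerr.blSigma a (E4.spatial x) + c ^ 2 * (Kerr.radius a x ^ 2 + a ^ 2) -
        2 * M * Kerr.radius a x * (1 + c) ^ 2 < 0 →
    ∀ (v : E4), Kerr.bilin M a x v v ≤ 0 → v ≠ 0 →
      Kerr.bilin M a x (Kerr.timeVector M a x) v < 0 →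
      (0 < 1 + 2 * Kerr.scalarH M a x * (1 + c) →
          0 < v 0 - c * Kerr.radiusGrad a (E4.spatial x) (E4.spatial v)) ∧
        (1 + 2 * Kerr.scalarH M a x * (1 + c) < 0 →
          v 0 - c * Kerr.radiusGrad a (E4.spatial x) (E4.spatial v) < 0) :=
  fun _ _ hM _ hx _ hnum _ hvv hv0 hVv =>
    ⟨fun hco => CollarCauchy.clock_pos hM hx hnum hco hvv hv0 hVv,
      fun hco => CollarCauchy.clock_neg hM hx hnum hco hvv hv0 hVv⟩

end Summit.FinalStateConjecture.FinalStateConjecture.Theorems.SwallowTheDatum.KerrShieldedSettles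

end
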